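import Mathlib
import HarnessLib
import Literature.Computability.AlgebraicComplexity.FlatteningRank
import Summits.MatrixMultiplication.MatrixMultiplication.Theorems.OutsiderSandwichTouchingExponent
import Summits.MatrixMultiplication.MatrixMultiplication.Theorems.OutsiderSandwichLaserFloorTop

/-!
# OutsiderSandwich — the CONTACT FACE: local–global split of the attacked crux, and the price of a cell

Route `route-MatrixMultiplication-OutsiderSandwich` (decomp-mm lens 4 «minimal counterexample /
extremal reduction», generation 15).  Cut of record (unchanged since g10):
`closes (h₁ : LaserTangency) (h₂ : LaserMergeOptimal) (h₃ : SummitIffLaserTangency)`.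

Notation (g11–g14).  `F` a universal spectral point of `ℂ`, `τ_F = log₂ F⟨2,2,2⟩ ∈ [2, ω]`,
`x_F = log₂ F(cw₂)`, laser floor `Λ(τ) = log₂ 3 + (τ − 2)/3` (`x_F ≥ Λ(τ_F)`, `laserFloor`),
`T = touchingExponents = {τ_F : x_F = Λ(τ_F)} ⊆ [2, ω]` compact, `τ* = sSup T`;
`LaserTangency ⟺ T ⊆ {2}`, `LaserMergeOptimal ⟺ ω ∈ T` (`OutsiderSandwichTouchingExponent`).

THIS FILE.

§1 `two_mem_touchingExponents` : the gauge corner touches — `2 ∈ T` UNCONDITIONALLY: Strassen's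
   first gauge point `ζ₁` (flattening rank) is a universal spectral point with `ζ₁⟨2,2,2⟩ = 4`,
   `ζ₁(cw₂) = 3`; hence `T ≠ ∅`, `min T = 2`, `τ* ∈ T`, `2 ≤ τ* ≤ ω` (g13 had `2 ∈ T` only relative
   to a supplied corner point).

§2–§4 THE LOCAL–GLOBAL SPLIT OF THE ATTACKED CRUX.  A counterexample to `LaserTangency` is a
   touching point with `τ_F > 2`; it is either NEAR the corner (an arbitrarily small deformation of
   the known extremal configuration — every universal point in print sits at the corner) or it lives
   on a FAR component of the contact face.  Accordingly
     `CornerIsolation`      (LOCAL) : `∃ ε > 0, T ∩ (2, 2+ε) = ∅` — the corner is an isolated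
                                     touching exponent (`cornerIsolation_iff`);
     `ContactFaceConnected` (GLOBAL): `T` is order-connected — between two touching exponents every
                                     height touches (`contactFaceConnected_iff`);
   (`ordConnected_of_pairStarConvex`: implied by PAIR STAR-CONVEXITY — interpolation of the pair
   spectrum `X(⟨2,2,2⟩,cw₂)` toward the gauge corner, known for `Δ_MM` (Strassen 1988 Thm. 6.5) and
   for graph tensors (Wigderson–Zuiddam), OPEN for the pair — under which the attacked crux becomes
   LOCAL: `LaserTangency ⟺ CornerIsolation`, `laserTangency_iff_cornerIsolation_of_pairStarConvex`);
   and `laserTangency_iff_local_global` : `LaserTangency ⟺ CornerIsolation ∧ ContactFaceConnected`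
   (⟸: a far touching exponent `t > 2` drags `[2, t] ⊆ T` by connectedness through the corner `2 ∈ T`,
   meeting `(2, 2+ε)`; ⟹: both are trivial from `T ⊆ {2}`).  Each piece is implied by `LaserTangency`,
   hence by `ω = 2`; neither is known to imply it.  Under `ContactFaceConnected` the contact face is
   the interval `T = [2, τ*]` (`touchingExponents_eq_Icc_of_ordConnected`) and the RESIDUAL crux reads
   «everything touches»: `LaserMergeOptimal ⟺ T = [2, ω]` (`laserMergeOptimal_iff_eq_Icc_of_ordConnected`).

§5–§7 (contact angle, price of a cell, necessity) are in the sibling files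
`OutsiderSandwichCornerAngle` and `OutsiderSandwichCellPrice`.

References: Strassen, J. reine angew. Math. 384 (1988) Thm. 2.3–2.4, 3.8; Strassen, J. reine angew.
Math. 413 (1991) §6; Christandl–Vrana–Zuiddam, J. AMS 36 (2023) Prop. 1.6, Cor. 3.31, Thm. 4.20;
Coppersmith–Winograd, JSC 9 (1990) §6–7; Bürgisser–Clausen–Shokrollahi (1997) 15.3, 15.41;
Alman–Li–Pratt, arXiv:2604.01386 §8 (edges of the matrix-multiplication spectrum).
-/

-- the problem's namespace `Summit.MatrixMultiplication.MatrixMultiplication` repeats the summit name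
set_option linter.dupNamespace false

namespace Summit.MatrixMultiplication.MatrixMultiplication.Theorems.OutsiderSandwichContactFace

open scoped Topology
open Filter
open Literature.Computability.AlgebraicComplexity
open Literature.Barriers.MatrixMultiplication (flatteningRank_cwTensor)
open Summit.MatrixMultiplication.MatrixMultiplication.Theses.OutsiderSandwich
open Summit.MatrixMultiplication.MatrixMultiplication.Theorems.OutsiderSandwichLaserFloor
  (one_le_map_matMulTensor two_le_matExp laserFloor rpow_matExp_le_map_matMulTensor)
open Summit.MatrixMultiplication.MatrixMultiplication.Theorems.OutsiderSandwichLaserFloorCut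
  (matExp_le_omega three_le_map_cwTensor)
open Summit.MatrixMultiplication.MatrixMultiplication.Theorems.OutsiderSandwichSpectralTransfer
  (map_unitTensor)
open Summit.MatrixMultiplication.MatrixMultiplication.Theorems.OutsiderSandwichPackingProfileLaser
  (perfectBeyondLaser_of_cwTwoMMPerfect)
open Summit.MatrixMultiplication.MatrixMultiplication.Theorems.OutsiderSandwichLaserTangency
  (laserTangency_of_summit)
open Summit.MatrixMultiplication.MatrixMultiplication.Theorems.OutsiderSandwichTouchingExponent
  (touchingExponents touchingExponents_subset_Icc bddAbove_touchingExponents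
    isCompact_touchingExponents two_mem_touchingExponents_of laserTangency_iff_subset_two
    laserMergeOptimal_iff_omega_mem laserTangency_iff_sSup_le laserMergeOptimal_iff_sSup_eq
    sSup_touchingExponents_le_omega)

variable {F : SpectralMap ℂ}

/-! ## §1  The gauge corner touches: `2 ∈ T` -/

/-- `ζ₁(cw₂) = 3` (the flattening rank of the concise tensor `cw₂ ∈ ℂ³⊗ℂ³⊗ℂ³`).
[cite: Strassen1988, Thm. 3.8; CoppersmithWinograd1990, §6] -/
theorem gaugePoint₁_cwTensor_two : gaugePoint₁ ℂ (cwTensor ℂ 2) = 3 := by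
  rw [gaugePoint₁_eq, flatteningRank_cwTensor (by norm_num : 1 ≤ 2)]
  norm_num

/-- `ζ₁⟨2,2,2⟩ = 4`. [cite: Strassen1988, Thm. 3.8] -/
theorem gaugePoint₁_matMulTensor_two : gaugePoint₁ ℂ (matMulTensor ℂ 2 2 2) = 4 := by
  have hG := gaugePoint₁_isUniversalSpectralPoint ℂ
  have h := hG.map_kronecker (unitTensor ℂ 1) (matMulTensor ℂ 2 2 2)
  rw [hG.map_unitTensor_one, one_mul, gaugePoint₁_eq,
    flatteningRank_multiple_matMulTensor 1 2 2 2 (by norm_num)] at h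
  rw [← h]; norm_num

/-- **The gauge corner is a touching point**: `2 ∈ T`, witnessed by Strassen's first gauge point
`ζ₁` (a universal spectral point with `ζ₁⟨2,2,2⟩ = 4 = 2²` and `ζ₁(cw₂) = 3 = 2^{Λ(2)}`).
[cite: Strassen1988, Thm. 2.3, 3.8] -/
theorem two_mem_touchingExponents : (2 : ℝ) ∈ touchingExponents :=
  two_mem_touchingExponents_of (gaugePoint₁_isUniversalSpectralPoint ℂ) gaugePoint₁_matMulTensor_two
    gaugePoint₁_cwTensor_two

/-- `T ≠ ∅`. [cite: Strassen1988, Thm. 2.3] -/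
theorem touchingExponents_nonempty : touchingExponents.Nonempty := ⟨2, two_mem_touchingExponents⟩

/-- `min T = 2`. [cite: Strassen1988, Thm. 2.3] -/
theorem isLeast_touchingExponents : IsLeast touchingExponents 2 :=
  ⟨two_mem_touchingExponents, fun _ ht => (touchingExponents_subset_Icc ht).1⟩

/-- `2 ≤ τ*`. [cite: Strassen1988, Thm. 2.3] -/
theorem two_le_sSup_touchingExponents : 2 ≤ sSup touchingExponents :=
  le_csSup bddAbove_touchingExponents two_mem_touchingExponents

/-- `τ* ∈ T` (compactness): the extremal touching point exists unconditionally. [cite: Strassen1988, Thm. 2.3] -/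
theorem sSup_touchingExponents_mem : sSup touchingExponents ∈ touchingExponents :=
  isCompact_touchingExponents.sSup_mem touchingExponents_nonempty

/-- `T ⊆ [2, τ*]`. [cite: Strassen1988, Thm. 2.3] -/
theorem touchingExponents_subset_Icc_sSup : touchingExponents ⊆ Set.Icc 2 (sSup touchingExponents) :=
  fun _ ht => ⟨(touchingExponents_subset_Icc ht).1, le_csSup bddAbove_touchingExponents ht⟩

/-! ## §2  The LOCAL piece: corner isolation -/

/-- **Corner isolation, set form**: the item's letter
`∃ ε > 0, ∀ F universal, τ_F < 2 + ε → x_F = Λ(τ_F) → τ_F = 2` says `T ∩ (2, 2 + ε) = ∅`.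
[cite: Strassen1988, Thm. 2.3] -/
theorem cornerIsolation_iff :
    (∃ ε : ℝ, 0 < ε ∧ ∀ F : SpectralMap ℂ, IsUniversalSpectralPoint ℂ F →
        Real.logb 2 (F (matMulTensor ℂ 2 2 2)) < 2 + ε →
        Real.logb 2 (F (cwTensor ℂ 2)) =
          Real.logb 2 3 + (Real.logb 2 (F (matMulTensor ℂ 2 2 2)) - 2) / 3 →
        Real.logb 2 (F (matMulTensor ℂ 2 2 2)) = 2) ↔
    ∃ ε : ℝ, 0 < ε ∧ touchingExponents ∩ Set.Ioo 2 (2 + ε) = ∅ := by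
  constructor
  · rintro ⟨ε, hε, h⟩
    refine ⟨ε, hε, Set.eq_empty_iff_forall_notMem.2 ?_⟩
    rintro t ⟨⟨G, hG, rfl, hGx⟩, ht1, ht2⟩
    have h2 := h G hG ht2 hGx
    linarith
  · rintro ⟨ε, hε, h⟩
    refine ⟨ε, hε, fun G hG hlt hGx => ?_⟩
    by_contra hne
    have h2 : 2 < Real.logb 2 (G (matMulTensor ℂ 2 2 2)) :=
      lt_of_le_of_ne (two_le_matExp hG) (Ne.symm hne)
    have hmem : Real.logb 2 (G (matMulTensor ℂ 2 2 2)) ∈ touchingExponents ∩ Set.Ioo 2 (2 + ε) :=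
      ⟨⟨G, hG, rfl, hGx⟩, h2, hlt⟩
    rw [h] at hmem
    exact hmem

/-- `LaserTangency ⟹ CornerIsolation` (with any `ε`; here `ε = 1`). [cite: Strassen1988, Thm. 2.3] -/
theorem cornerIsolation_of_laserTangency (h : LaserTangency) :
    ∃ ε : ℝ, 0 < ε ∧ ∀ F : SpectralMap ℂ, IsUniversalSpectralPoint ℂ F →
        Real.logb 2 (F (matMulTensor ℂ 2 2 2)) < 2 + ε →
        Real.logb 2 (F (cwTensor ℂ 2)) =
          Real.logb 2 3 + (Real.logb 2 (F (matMulTensor ℂ 2 2 2)) - 2) / 3 →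
        Real.logb 2 (F (matMulTensor ℂ 2 2 2)) = 2 := by
  refine ⟨1, one_pos, fun G hG _ hGx => ?_⟩
  exact Set.mem_singleton_iff.1 (laserTangency_iff_subset_two.1 h ⟨G, hG, rfl, hGx⟩)

/-! ## §3  The GLOBAL piece: the contact face is connected -/

/-- **Contact-face connectedness, set form**: the item's letter (between two touching points every
height is the height of a touching point) says `T` is order-connected. [cite: Strassen1988, Thm. 2.3] -/
theorem contactFaceConnected_iff :
    (∀ F G : SpectralMap ℂ, IsUniversalSpectralPoint ℂ F → IsUniversalSpectralPoint ℂ G →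
        Real.logb 2 (F (cwTensor ℂ 2)) =
          Real.logb 2 3 + (Real.logb 2 (F (matMulTensor ℂ 2 2 2)) - 2) / 3 →
        Real.logb 2 (G (cwTensor ℂ 2)) =
          Real.logb 2 3 + (Real.logb 2 (G (matMulTensor ℂ 2 2 2)) - 2) / 3 →
        ∀ t : ℝ, Real.logb 2 (F (matMulTensor ℂ 2 2 2)) ≤ t →
          t ≤ Real.logb 2 (G (matMulTensor ℂ 2 2 2)) →
          ∃ H : SpectralMap ℂ, IsUniversalSpectralPoint ℂ H ∧
            Real.logb 2 (H (matMulTensor ℂ 2 2 2)) = t ∧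
            Real.logb 2 (H (cwTensor ℂ 2)) = Real.logb 2 3 + (t - 2) / 3) ↔
    touchingExponents.OrdConnected := by
  constructor
  · intro h
    refine ⟨fun a ha b hb t ht => ?_⟩
    obtain ⟨Fa, hFa, hFat, hFax⟩ := ha
    obtain ⟨Gb, hGb, hGbt, hGbx⟩ := hb
    subst hFat
    subst hGbt
    obtain ⟨H, hH, hHt, hHx⟩ := h Fa Gb hFa hGb hFax hGbx t ht.1 ht.2
    exact ⟨H, hH, hHt, hHx⟩
  · intro h Fa Gb hFa hGb hFax hGbx t h1 h2
    obtain ⟨H, hH, hHt, hHx⟩ :=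
      h.out (⟨Fa, hFa, rfl, hFax⟩ : _ ∈ touchingExponents) ⟨Gb, hGb, rfl, hGbx⟩ ⟨h1, h2⟩
    exact ⟨H, hH, hHt, hHx⟩

/-- `LaserTangency ⟹ ContactFaceConnected` (`T ⊆ {2}` is an interval). [cite: Strassen1988, Thm. 2.3] -/
theorem ordConnected_of_laserTangency (h : LaserTangency) : touchingExponents.OrdConnected := by
  have hsub := laserTangency_iff_subset_two.1 h
  refine ⟨fun a ha b hb t ht => ?_⟩
  have ha2 : a = 2 := Set.mem_singleton_iff.1 (hsub ha)
  have hb2 : b = 2 := Set.mem_singleton_iff.1 (hsub hb)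
  obtain ⟨ht1, ht2⟩ := ht
  have htt : t = 2 := by rw [ha2] at ht1; rw [hb2] at ht2; exact le_antisymm ht2 ht1
  rw [htt]
  exact two_mem_touchingExponents

/-- **Pair star-convexity ⟹ the contact face is connected.**  If the PAIR spectrum
`X(⟨2,2,2⟩, cw₂)` interpolates toward the gauge corner — for every universal `F` and `λ ∈ [0,1]` some
universal `H` has `H⟨2,2,2⟩ = 4^{1−λ}·F⟨2,2,2⟩^λ` and `H(cw₂) ≤ 3^{1−λ}·F(cw₂)^λ` (the letter of the
route item `PairStarConvexity`; for the matrix-shape spectrum `Δ_MM` this is Strassen's star-convexity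
theorem, for graph tensors Wigderson–Zuiddam's interpolation theorem; for the pair it is OPEN) — then
`T` is order-connected: the interpolants of a touching point run along the chord from the corner,
and the chord IS the floor line. [cite: Strassen1988, Thm. 6.5; AlmanLiPratt2026, Thm. 2.3, Rem. 3.2] -/
theorem ordConnected_of_pairStarConvex
    (h : ∀ F : SpectralMap ℂ, IsUniversalSpectralPoint ℂ F → ∀ l : ℝ, 0 ≤ l → l ≤ 1 →
      ∃ H : SpectralMap ℂ, IsUniversalSpectralPoint ℂ H ∧
        H (matMulTensor ℂ 2 2 2) = (4 : ℝ) ^ (1 - l) * F (matMulTensor ℂ 2 2 2) ^ l ∧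
        H (cwTensor ℂ 2) ≤ (3 : ℝ) ^ (1 - l) * F (cwTensor ℂ 2) ^ l) :
    touchingExponents.OrdConnected := by
  refine ⟨fun a ha b hb t ht => ?_⟩
  obtain ⟨G, hG, rfl, hGx⟩ := hb
  have ha2 : 2 ≤ a := (touchingExponents_subset_Icc ha).1
  obtain ⟨hat, htb⟩ := ht
  have ht2 : 2 ≤ t := ha2.trans hat
  rcases eq_or_lt_of_le htb with heq | hlt
  · rw [heq]; exact ⟨G, hG, rfl, hGx⟩
  -- interpolate with weight l = (t - 2) / (τ_G - 2)
  set τ := Real.logb 2 (G (matMulTensor ℂ 2 2 2)) with hτ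
  have hτ2 : 2 < τ := lt_of_le_of_lt ht2 hlt
  have hd : 0 < τ - 2 := sub_pos.2 hτ2
  set l := (t - 2) / (τ - 2) with hl
  have hl0 : 0 ≤ l := div_nonneg (sub_nonneg.2 ht2) hd.le
  have hl1 : l ≤ 1 := (div_le_one hd).2 (by linarith)
  have hlt' : l * (τ - 2) = t - 2 := by rw [hl]; field_simp
  obtain ⟨H, hH, hHm, hHc⟩ := h G hG l hl0 hl1
  have hGm0 : 0 < G (matMulTensor ℂ 2 2 2) :=
    lt_of_lt_of_le one_pos (one_le_map_matMulTensor hG (by norm_num))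
  have hGc0 : 0 < G (cwTensor ℂ 2) := lt_of_lt_of_le (by norm_num) (three_le_map_cwTensor hG)
  have hHc0 : 0 < H (cwTensor ℂ 2) := lt_of_lt_of_le (by norm_num) (three_le_map_cwTensor hH)
  -- τ_H = t
  have hHt : Real.logb 2 (H (matMulTensor ℂ 2 2 2)) = t := by
    rw [hHm, Real.logb_mul (Real.rpow_pos_of_pos (by norm_num) _).ne' (Real.rpow_pos_of_pos hGm0 _).ne',
      Real.logb_rpow_eq_mul_logb_of_pos (by norm_num : (0:ℝ) < 4),
      Real.logb_rpow_eq_mul_logb_of_pos hGm0, ← hτ,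
      show Real.logb 2 (4 : ℝ) = 2 by
        rw [show (4 : ℝ) = 2 ^ (2 : ℝ) by norm_num, Real.logb_rpow two_pos (by norm_num)]]
    linear_combination hlt'
  -- x_H ≤ Λ(t)
  have hHx_le : Real.logb 2 (H (cwTensor ℂ 2)) ≤ Real.logb 2 3 + (t - 2) / 3 := by
    have h1 := Real.logb_le_logb_of_le (b := 2) one_lt_two hHc0 hHc
    rw [Real.logb_mul (Real.rpow_pos_of_pos (by norm_num) _).ne' (Real.rpow_pos_of_pos hGc0 _).ne',
      Real.logb_rpow_eq_mul_logb_of_pos (by norm_num : (0:ℝ) < 3),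
      Real.logb_rpow_eq_mul_logb_of_pos hGc0, hGx] at h1
    have : (1 - l) * Real.logb 2 3 + l * (Real.logb 2 3 + (τ - 2) / 3) = Real.logb 2 3 + (t - 2) / 3 := by
      linear_combination hlt' / 3
    linarith
  -- x_H ≥ Λ(τ_H) = Λ(t): the laser floor
  have hHx_ge := laserFloor hH
  rw [hHt] at hHx_ge
  exact ⟨H, hH, hHt, le_antisymm hHx_le hHx_ge⟩

/-! ## §4  The split: `LaserTangency ⟺ CornerIsolation ∧ ContactFaceConnected` -/

/-- **Local–global split of the attacked crux, set form**:
`T ⊆ {2} ⟺ (∃ ε > 0, T ∩ (2,2+ε) = ∅) ∧ T order-connected`.  ⟸: a touching exponent `t > 2` gives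
`[2, t] ⊆ T` (connectedness through the corner `2 ∈ T`), which meets `(2, 2+ε)`.
[cite: Strassen1988, Thm. 2.3, 3.8] -/
theorem laserTangency_iff_isolated_and_ordConnected :
    LaserTangency ↔
      (∃ ε : ℝ, 0 < ε ∧ touchingExponents ∩ Set.Ioo 2 (2 + ε) = ∅) ∧ touchingExponents.OrdConnected := by
  constructor
  · intro h
    exact ⟨cornerIsolation_iff.1 (cornerIsolation_of_laserTangency h), ordConnected_of_laserTangency h⟩
  · rintro ⟨⟨ε, hε, hI⟩, hC⟩
    rw [laserTangency_iff_subset_two]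
    intro t ht
    rw [Set.mem_singleton_iff]
    by_contra hne
    have ht2 : 2 < t := lt_of_le_of_ne (touchingExponents_subset_Icc ht).1 (Ne.symm hne)
    have hsT : min t (2 + ε / 2) ∈ touchingExponents :=
      hC.out two_mem_touchingExponents ht ⟨le_min ht2.le (by linarith), min_le_left _ _⟩
    have hsI : min t (2 + ε / 2) ∈ Set.Ioo 2 (2 + ε) :=
      ⟨lt_min ht2 (by linarith), lt_of_le_of_lt (min_le_right _ _) (by linarith)⟩
    have hmem : min t (2 + ε / 2) ∈ touchingExponents ∩ Set.Ioo 2 (2 + ε) := ⟨hsT, hsI⟩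
    rw [hI] at hmem
    exact hmem

/-- **Local–global split of the attacked crux** (the route item `LaserTangencyLocalGlobal`, letters of
`CornerIsolation` and `ContactFaceConnected` spelled out):
`LaserTangency ⟺ CornerIsolation ∧ ContactFaceConnected`.
[cite: Strassen1988, Thm. 2.3, 3.8] -/
theorem laserTangency_iff_local_global :
    LaserTangency ↔
      (∃ ε : ℝ, 0 < ε ∧ ∀ F : SpectralMap ℂ, IsUniversalSpectralPoint ℂ F →
          Real.logb 2 (F (matMulTensor ℂ 2 2 2)) < 2 + ε →
          Real.logb 2 (F (cwTensor ℂ 2)) =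
            Real.logb 2 3 + (Real.logb 2 (F (matMulTensor ℂ 2 2 2)) - 2) / 3 →
          Real.logb 2 (F (matMulTensor ℂ 2 2 2)) = 2) ∧
      (∀ F G : SpectralMap ℂ, IsUniversalSpectralPoint ℂ F → IsUniversalSpectralPoint ℂ G →
          Real.logb 2 (F (cwTensor ℂ 2)) =
            Real.logb 2 3 + (Real.logb 2 (F (matMulTensor ℂ 2 2 2)) - 2) / 3 →
          Real.logb 2 (G (cwTensor ℂ 2)) =
            Real.logb 2 3 + (Real.logb 2 (G (matMulTensor ℂ 2 2 2)) - 2) / 3 →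
          ∀ t : ℝ, Real.logb 2 (F (matMulTensor ℂ 2 2 2)) ≤ t →
            t ≤ Real.logb 2 (G (matMulTensor ℂ 2 2 2)) →
            ∃ H : SpectralMap ℂ, IsUniversalSpectralPoint ℂ H ∧
              Real.logb 2 (H (matMulTensor ℂ 2 2 2)) = t ∧
              Real.logb 2 (H (cwTensor ℂ 2)) = Real.logb 2 3 + (t - 2) / 3) := by
  rw [cornerIsolation_iff, contactFaceConnected_iff]
  exact laserTangency_iff_isolated_and_ordConnected

/-- **Interval normal form**: under `ContactFaceConnected` the contact face is the interval
`T = [2, τ*]`. [cite: Strassen1988, Thm. 2.3] -/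
theorem touchingExponents_eq_Icc_of_ordConnected (hC : touchingExponents.OrdConnected) :
    touchingExponents = Set.Icc 2 (sSup touchingExponents) :=
  Set.Subset.antisymm touchingExponents_subset_Icc_sSup
    (hC.out two_mem_touchingExponents sSup_touchingExponents_mem)

/-- Under `ContactFaceConnected` the RESIDUAL crux says that everything touches:
`LaserMergeOptimal ⟺ T = [2, ω]`. [cite: Strassen1988, Thm. 2.3–2.4] -/
theorem laserMergeOptimal_iff_eq_Icc_of_ordConnected (hC : touchingExponents.OrdConnected) :
    LaserMergeOptimal ↔ touchingExponents = Set.Icc 2 (omega ℂ) := by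
  rw [laserMergeOptimal_iff_sSup_eq]
  constructor
  · intro h
    rw [← h]
    exact touchingExponents_eq_Icc_of_ordConnected hC
  · intro h
    have hmem : omega ℂ ∈ touchingExponents := by
      rw [h]
      exact ⟨omega_two_le ℂ, le_rfl⟩
    exact le_antisymm sSup_touchingExponents_le_omega (le_csSup bddAbove_touchingExponents hmem)

/-- Under `ContactFaceConnected` the whole cut of record is a statement about ONE interval:
`ω = 2 ⟺ [2, τ*] = {2} = [2, ω]`, i.e. `⟺ τ* = 2 ∧ τ* = ω`. [cite: Strassen1988, Thm. 2.3–2.4] -/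
theorem summit_iff_of_ordConnected (hC : touchingExponents.OrdConnected) :
    _root_.MatrixMultiplication ↔ sSup touchingExponents = 2 ∧ sSup touchingExponents = omega ℂ := by
  rw [OutsiderSandwichTouchingExponent.summit_iff_sSup]
  have _ := hC
  constructor
  · rintro ⟨h1, h2⟩
    exact ⟨le_antisymm h1 two_le_sSup_touchingExponents, h2⟩
  · rintro ⟨h1, h2⟩
    exact ⟨h1.le, h2⟩

/-- **Under pair star-convexity the attacked crux is LOCAL**: `PairStarConvexity ⟹
(LaserTangency ⟺ CornerIsolation)` — the minimal counterexample can be slid down the floor line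
into any neighbourhood of the gauge corner. [cite: Strassen1988, Thm. 6.5; AlmanLiPratt2026, Thm. 2.3] -/
theorem laserTangency_iff_cornerIsolation_of_pairStarConvex
    (h : ∀ F : SpectralMap ℂ, IsUniversalSpectralPoint ℂ F → ∀ l : ℝ, 0 ≤ l → l ≤ 1 →
      ∃ H : SpectralMap ℂ, IsUniversalSpectralPoint ℂ H ∧
        H (matMulTensor ℂ 2 2 2) = (4 : ℝ) ^ (1 - l) * F (matMulTensor ℂ 2 2 2) ^ l ∧
        H (cwTensor ℂ 2) ≤ (3 : ℝ) ^ (1 - l) * F (cwTensor ℂ 2) ^ l) :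
    LaserTangency ↔
      ∃ ε : ℝ, 0 < ε ∧ ∀ F : SpectralMap ℂ, IsUniversalSpectralPoint ℂ F →
        Real.logb 2 (F (matMulTensor ℂ 2 2 2)) < 2 + ε →
        Real.logb 2 (F (cwTensor ℂ 2)) =
          Real.logb 2 3 + (Real.logb 2 (F (matMulTensor ℂ 2 2 2)) - 2) / 3 →
        Real.logb 2 (F (matMulTensor ℂ 2 2 2)) = 2 := by
  rw [cornerIsolation_iff, laserTangency_iff_isolated_and_ordConnected]
  exact ⟨fun h' => h'.1, fun h' => ⟨h', ordConnected_of_pairStarConvex h⟩⟩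

/-! ## §5  By-name links to the route items (rev 19) -/

/-- closes item stmt-MatrixMultiplication-27972 `LaserTangencyLocalGlobal`. [cite: Strassen1988, Thm. 2.3, 3.8] -/
theorem laserTangencyLocalGlobal_holds : LaserTangencyLocalGlobal := laserTangency_iff_local_global

/-- edge: `LaserTangency (32268) ⟹ CornerIsolation (27968) ∧ ContactFaceConnected (27969)`.
[cite: Strassen1988, Thm. 2.3] -/
theorem local_global_of_laserTangency (h : LaserTangency) : CornerIsolation ∧ ContactFaceConnected :=
  laserTangencyLocalGlobal_holds.1 h

/-- edge: `PairStarConvexity (27970) ⟹ ContactFaceConnected (27969)`. [cite: Strassen1988, Thm. 6.5] -/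
theorem contactFaceConnected_of_pairStarConvexity (h : PairStarConvexity) : ContactFaceConnected :=
  contactFaceConnected_iff.2 (ordConnected_of_pairStarConvex h)

/-- edge: `PairStarConvexity (27970) ⟹ (LaserTangency (32268) ⟺ CornerIsolation (27968))`.
[cite: Strassen1988, Thm. 6.5] -/
theorem laserTangency_iff_cornerIsolation_of_pairStarConvexity (h : PairStarConvexity) :
    LaserTangency ↔ CornerIsolation :=
  laserTangency_iff_cornerIsolation_of_pairStarConvex h

end Summit.MatrixMultiplication.MatrixMultiplication.Theorems.OutsiderSandwichContactFace
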